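import Mathlib
import HarnessLib

/-!
# The Level Principle FAILS for connection events: an 8-vertex, 12-edge counterexample to levelwise Harris

Helper file for crux `stmt-CriticalPhenomena-4575` (new-inequality factory `prim-ineq-gen-1`, gen 14); memo
`run/shared/lean/prim/prim-ineq-gen-1/FINDING-20-cp-rank-three.md` §0 (V0), §7.

FINDING-17 (gen 11) proposed the *Level Principle*: for two connection events `A = [a ↔ v]`, `B = [b ↔ c]` of a finite
(multi)graph, the antipodal Harris sum `∑_W (1_A(W) − 1_A(Wᶜ))(1_B(W) − 1_B(Wᶜ))` over the spanning subgraphs `W` of a fixed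
*level* `k(W) + k(Wᶜ) = s` (`k` = number of connected components) is nonnegative; it was verified on every connected multigraph with
`≤ 7` vertices and `≤ 10` edges (≈ 3.9·10¹² level cells).  It is false.  Take the graph `G₈` on the vertices `0,…,7` with the twelve
edges `e₀,…,e₁₁ = 02, 21, 03, 31, 04, 41, 05, 51, 62, 27, 63, 37` (a `K_{2,4}` between the hubs `0, 1` with middle vertices `2,3,4,5`,
plus the vertices `6, 7` both joined to the middle vertices `2` and `3`), and the events `A = [6 ↔ 7]`, `B = [4 ↔ 5]`.  The level sums
for `k(W)+k(Wᶜ) = 9, 8, 7, 6, 5, 4` are `2, 20, 62, 44, −40, 32`: the level `k(W)+k(Wᶜ) = 5` (i.e. `λ = 4 = r − 3`) is NEGATIVE (440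
colourings contribute `+1`, 480 contribute `−1`); the total over all levels is `120 ≥ 0`, as Harris' inequality demands.  Companion
matroid-level counterexamples (GMC fails on `M(K_{2,8})`, `M(K_{2,9})` with principal modular cuts) are in the memo, §1.1.  This file certifies the
negative level by kernel computation (`decide +kernel` on a packed-bitmask reachability encoding of the `2¹²` spanning subgraphs,
summed by a balanced binary tree; ≈ 45 s); the other five level sums were computed by two independent programs (memo §1.2) and are
not re-certified here to keep elaboration short.
(This work, 2026-08-20.)
-/

namespace Summit.CriticalPhenomena.PercolationContinuityZ3.Theorems

namespace LevelHarrisConnCex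

/-- Endpoints of the twelve edges `e₀,…,e₁₁` of `G₈`. [this work] -/
def ends : ℕ → ℕ × ℕ
  | 0 => (0, 2) | 1 => (2, 1) | 2 => (0, 3) | 3 => (3, 1) | 4 => (0, 4) | 5 => (4, 1)
  | 6 => (0, 5) | 7 => (5, 1) | 8 => (6, 2) | 9 => (2, 7) | 10 => (6, 3) | 11 => (3, 7)
  | _ => (0, 0)

/-- The eight reachability bitmasks of a spanning subgraph are packed into one natural number: bit `8·x + y` means
`y` is reachable from `x`.  `lanes` selects bit `0` of each of the eight bytes. [this work] -/
def lanes : ℕ := 0x0101010101010101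

/-- Propagate all eight packed reachability masks along edge `k` (if it belongs to the subgraph with edge bitmask `W`). [this work] -/
def push (W : ℕ) (k : ℕ) (R : ℕ) : ℕ :=
  if W.testBit k then
    R ||| (((R >>> (ends k).1) &&& lanes) <<< (ends k).2) ||| (((R >>> (ends k).2) &&& lanes) <<< (ends k).1)
  else R

/-- One full propagation round over the twelve edges. [this work] -/
def step (W R : ℕ) : ℕ :=
  push W 11 (push W 10 (push W 9 (push W 8 (push W 7 (push W 6 (push W 5 (push W 4 (push W 3 (push W 2 (push W 1 (push W 0 R)))))))))))

/-- The diagonal start configuration: byte `x` has bit `x` set. [this work] -/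
def diag : ℕ := 0x8040201008040201

/-- Packed reachability of the spanning subgraph `W` (seven rounds suffice on eight vertices). [this work] -/
def reach (W : ℕ) : ℕ := step W (step W (step W (step W (step W (step W (step W diag))))))

/-- `x` and `y` are connected in the subgraph whose packed reachability is `R`. [this work] -/
def connR (R x y : ℕ) : Bool := R.testBit (8 * x + y)

/-- `x` is the smallest vertex of its component (as `0/1`), read off the packed reachability `R`. [this work] -/
def isMinR (R x : ℕ) : ℕ := if (R >>> (8 * x)) &&& (2 ^ x - 1) = 0 then 1 else 0

/-- Number of connected components, read off the packed reachability `R`. [this work] -/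
def ncompR (R : ℕ) : ℕ :=
  isMinR R 0 + isMinR R 1 + isMinR R 2 + isMinR R 3 + isMinR R 4 + isMinR R 5 + isMinR R 6 + isMinR R 7

/-- Antipodal spin of the connection event `[x ↔ y]` from the packed reachabilities of `W` and of its complement. [this work] -/
def spinR (R Rc x y : ℕ) : ℤ :=
  (if connR R x y then 1 else 0) - (if connR Rc x y then 1 else 0)

/-- Contribution of the colouring `W` (complement `4095 − W`) to the level-`s` antipodal Harris sum of `[6 ↔ 7]` and `[4 ↔ 5]`. [this work] -/
def term (s W : ℕ) : ℤ :=
  let R := reach W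
  let Rc := reach (4095 - W)
  if ncompR R + ncompR Rc = s then spinR R Rc 6 7 * spinR R Rc 4 5 else 0

/-- Balanced binary summation of `term s` over the `2^d` bitmasks `w₀, …, w₀ + 2^d − 1` (keeps kernel reduction shallow). [this work] -/
def sumTree (s : ℕ) : ℕ → ℕ → ℤ
  | 0, w₀ => term s w₀
  | d + 1, w₀ => sumTree s d w₀ + sumTree s d (w₀ + 2 ^ d)

/-- The antipodal Harris sum of `A = [6 ↔ 7]` and `B = [4 ↔ 5]` over all colourings `W ⊆ E(G₈)` with `k(W) + k(Wᶜ) = s`. [this work] -/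
def levelSum (s : ℕ) : ℤ := sumTree s 12 0

/-- Level `k(W)+k(Wᶜ) = 5` (`λ = 4`) of the antipodal Harris sum of `[6 ↔ 7]` and `[4 ↔ 5]` on `G₈` is NEGATIVE (`= −40`): the Level
Principle for connection events fails. [this work] -/
theorem levelSum_five : levelSum 5 = -40 := by
  decide +kernel

/-- Sanity of the encoding: the full edge set is connected (one component) and the empty one has eight components. [this work] -/
theorem ncomp_full_and_empty : ncompR (reach 4095) = 1 ∧ ncompR (reach 0) = 8 := by
  decide +kernel

/-- Sanity of the encoding: in the subgraph `{62, 27}` (edge bitmask `2^8 + 2^9`) the vertices `6, 7` are connected and `4, 5` are not.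
[this work] -/
theorem conn_example : connR (reach (2 ^ 8 + 2 ^ 9)) 6 7 = true ∧ connR (reach (2 ^ 8 + 2 ^ 9)) 4 5 = false := by
  decide +kernel

/-- Some level of the antipodal Harris sum of two connection events is negative. [this work] -/
theorem exists_negative_level : ∃ s, levelSum s < 0 :=
  ⟨5, by rw [levelSum_five]; decide⟩

end LevelHarrisConnCex

end Summit.CriticalPhenomena.PercolationContinuityZ3.Theorems
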